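import Literature.MathematicalPhysics.StatisticalMechanics.LocalMatchingCompactness
import Summits.AtomisticToContinuum.Crystallization.Theorems.ExcessDecayLiouvilleFineGrainsPigeonholeBall
import HarnessLib

/-!
# `HullExactShells` (route `HullExactificationCascade`, item stmt-AtomisticToContinuum-12092):
# local limits of a fixed ground-state family, and defect-free balls

Helper file (supports `HullExactificationCascade.HullExactShells`).  Throughout, `x : (N : ℕ) →
(Fin N → E)` is a FIXED family of finite configurations and "`X` is a local limit of `x`" is the
route's inline clause: for some strictly increasing `φ` and translations `τ_j`, for every radius `R`
and every `ε > 0`, eventually in `j`, the translated configuration `x (φ j) + τ_j` and `X` are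
two-way `ε`-matched on the ball `‖·‖ ≤ R`.

* `isLimit_preimage_add_const` — local limits of `x` are translation invariant;
* `isLimit_of_eventually_ballMatch` — **local limits of local limits of `x` are local limits of
  `x`** (diagonal argument; the fixed-family analogue of
  `IsLocalLimitOfGroundStates.of_eventually_ballMatch` of `LocalLimitOfGroundStates.lean`, from
  which the bookkeeping is adapted);
* `zero_mem_of_ballMatch` — the origin survives in a separated local limit of rooted sets;
* `exists_ball_forall_not` — **defect-free balls** in `ℝ³`: if the defective points of a
  `δ`-separated set `S ⊆ ℝ³` have density zero uniformly over balls
  (`#{defective in B̄_L(0)} ≤ θ L³` for all large `L`, every `θ > 0`), then for every `r` some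
  open `r`-ball contains no defective point of `S` (cubic grid of `n³` disjoint `r`-balls inside
  `B̄_{5rn}(0)`, pigeonhole; the grid lemmas are those of
  `ExcessDecayLiouvilleFineGrainsPigeonholeBall.lean`).

The first three hold in any real normed group `E`.  All `[folklore]` (Baake–Grimm 2013, Remark 5.6,
local rubber topology; Radin 1991 §2 for the hull).  No new definitions; nothing here closes an
item.
-/

noncomputable section

namespace Summit.AtomisticToContinuum.Crystallization.Theorems.HullExactShells

open scoped Topology
open Filter Set Metric
open Literature.MathematicalPhysics.StatisticalMechanics
open Summit.AtomisticToContinuum.Crystallization.Theorems.ExcessDecayLiouvilleFineGrains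
  (norm_le_two_mul_of_abs_apply_le le_norm_grid_sub)

section General

variable {E : Type*} [NormedAddCommGroup E]

/-! ## Elementary metric facts -/

/-- `‖a‖ ≤ ‖b‖ + dist a b`. [folklore] -/
theorem norm_le_norm_add_dist (a b : E) : ‖a‖ ≤ ‖b‖ + dist a b := by
  rw [dist_eq_norm]
  linarith [norm_sub_norm_le a b]

/-- Separation passes to translates: if `S` is `δ`-separated then so is `S - v = (· + v) ⁻¹' S`.
[folklore] -/
theorem sep_preimage_add_const {S : Set E} {δ : ℝ}
    (hsep : ∀ p ∈ S, ∀ q ∈ S, p ≠ q → δ ≤ dist p q) (v : E) :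
    ∀ p ∈ (fun z => z + v) ⁻¹' S, ∀ q ∈ (fun z => z + v) ⁻¹' S, p ≠ q → δ ≤ dist p q := by
  intro p hp q hq hpq
  have h := hsep (p + v) hp (q + v) hq fun h => hpq (add_right_cancel h)
  rwa [dist_add_right] at h

/-! ## Local limits of a fixed family: translation invariance -/

/-- Local limits of the fixed family `x` are translation invariant: if `X` is a local limit of
`x` along `(φ, τ)`, then `X - v = (· + v) ⁻¹' X` is a local limit along `(φ, τ - v)` (enlarge the
radius by `‖v‖`). [folklore] -/
theorem isLimit_preimage_add_const {x : (N : ℕ) → (Fin N → E)} {X : Set E}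
    (h : ∃ φ : ℕ → ℕ, StrictMono φ ∧ ∃ τ : ℕ → E, ∀ R ε : ℝ, 0 < ε → ∀ᶠ j : ℕ in atTop,
      (∀ s ∈ X, ‖s‖ ≤ R → ∃ i : Fin (φ j), dist (x (φ j) i + τ j) s ≤ ε) ∧
        (∀ i : Fin (φ j), ‖x (φ j) i + τ j‖ ≤ R → ∃ s ∈ X, dist (x (φ j) i + τ j) s ≤ ε))
    (v : E) :
    ∃ φ : ℕ → ℕ, StrictMono φ ∧ ∃ τ : ℕ → E, ∀ R ε : ℝ, 0 < ε → ∀ᶠ j : ℕ in atTop,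
      (∀ s ∈ (fun z => z + v) ⁻¹' X, ‖s‖ ≤ R → ∃ i : Fin (φ j), dist (x (φ j) i + τ j) s ≤ ε) ∧
        (∀ i : Fin (φ j), ‖x (φ j) i + τ j‖ ≤ R →
          ∃ s ∈ (fun z => z + v) ⁻¹' X, dist (x (φ j) i + τ j) s ≤ ε) := by
  obtain ⟨φ, hφ, τ, hlim⟩ := h
  refine ⟨φ, hφ, fun j => τ j - v, fun R ε hε => ?_⟩
  filter_upwards [hlim (R + ‖v‖) ε hε] with j hj
  obtain ⟨hA, hB⟩ := hj
  refine ⟨fun s hs hsR => ?_, fun i hi => ?_⟩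
  · have hsR' : ‖s + v‖ ≤ R + ‖v‖ := (norm_add_le _ _).trans (by linarith)
    obtain ⟨i, hi⟩ := hA (s + v) hs hsR'
    refine ⟨i, ?_⟩
    rwa [← add_sub_assoc, ← dist_add_right _ _ v, sub_add_cancel]
  · have hiR : ‖x (φ j) i + τ j‖ ≤ R + ‖v‖ := by
      have h1 : ‖x (φ j) i + τ j‖ ≤ ‖x (φ j) i + (τ j - v)‖ + ‖v‖ :=
        calc ‖x (φ j) i + τ j‖ = ‖x (φ j) i + (τ j - v) + v‖ := by
              congr 1; abel
          _ ≤ ‖x (φ j) i + (τ j - v)‖ + ‖v‖ := norm_add_le _ _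
      linarith
    obtain ⟨p, hp, hip⟩ := hB i hiR
    refine ⟨p - v, ?_, ?_⟩
    · show p - v + v ∈ X
      rwa [sub_add_cancel]
    · rwa [← dist_add_right _ _ v, sub_add_cancel, add_assoc, sub_add_cancel]

/-! ## Local limits of local limits (diagonal argument) -/

/-- **Local limits of local limits of `x` are local limits of `x`.** If every `X_k` is a local
limit of the fixed family `x` and `X_k → X` locally (for every `R` and `ε > 0`, eventually in `k`,
`BallMatch ε R 0 (X_k) X`), then `X` is a local limit of `x`.  Diagonal argument: match `X_k` at
scale `(k, 1/(k+1))` by the `j_k`-th term of its own witness sequence, the indices `j_k` chosen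
recursively so that the particle numbers `φ_k (j_k)` increase strictly. [folklore] -/
theorem isLimit_of_eventually_ballMatch {x : (N : ℕ) → (Fin N → E)} {Xs : ℕ → Set E} {X : Set E}
    (hXs : ∀ k, ∃ φ : ℕ → ℕ, StrictMono φ ∧ ∃ τ : ℕ → E, ∀ R ε : ℝ, 0 < ε → ∀ᶠ j : ℕ in atTop,
      (∀ s ∈ Xs k, ‖s‖ ≤ R → ∃ i : Fin (φ j), dist (x (φ j) i + τ j) s ≤ ε) ∧
        (∀ i : Fin (φ j), ‖x (φ j) i + τ j‖ ≤ R → ∃ s ∈ Xs k, dist (x (φ j) i + τ j) s ≤ ε))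
    (hlim : ∀ R ε : ℝ, 0 < ε → ∀ᶠ k : ℕ in atTop, BallMatch ε R 0 (Xs k) X) :
    ∃ φ : ℕ → ℕ, StrictMono φ ∧ ∃ τ : ℕ → E, ∀ R ε : ℝ, 0 < ε → ∀ᶠ j : ℕ in atTop,
      (∀ s ∈ X, ‖s‖ ≤ R → ∃ i : Fin (φ j), dist (x (φ j) i + τ j) s ≤ ε) ∧
        (∀ i : Fin (φ j), ‖x (φ j) i + τ j‖ ≤ R → ∃ s ∈ X, dist (x (φ j) i + τ j) s ≤ ε) := by
  classical
  choose φ hφ τ hmatch using hXs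
  -- thresholds `J k` for the matching of `X_k` at scale `(k, 1/(k+1))`
  have hth := fun k : ℕ =>
    Filter.eventually_atTop.1 (hmatch k (k : ℝ) (1 / ((k : ℝ) + 1)) (by positivity))
  choose J hJ using hth
  -- diagonal indices `d 0 = J 0`, `d (k+1) = max (J (k+1)) (φ k (d k) + 1)`
  obtain ⟨d, hd0, hdS⟩ : ∃ d : ℕ → ℕ, d 0 = J 0 ∧
      ∀ k, d (k + 1) = max (J (k + 1)) (φ k (d k) + 1) :=
    ⟨fun k => Nat.rec (J 0) (fun k ih => max (J (k + 1)) (φ k ih + 1)) k, rfl, fun _ => rfl⟩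
  have hdJ : ∀ k, J k ≤ d k := fun k => by
    cases k with
    | zero => rw [hd0]
    | succ k => rw [hdS]; exact le_max_left _ _
  have hN : StrictMono fun k => φ k (d k) := strictMono_nat_of_lt_succ fun k =>
    calc φ k (d k) < φ k (d k) + 1 := Nat.lt_succ_self _
      _ ≤ d (k + 1) := by rw [hdS]; exact le_max_right _ _
      _ ≤ φ (k + 1) (d (k + 1)) := (hφ (k + 1)).le_apply
  refine ⟨fun k => φ k (d k), hN, fun k => τ k (d k), fun R ε hε => ?_⟩
  -- work at tolerance `ε₁ ≤ min (ε/2) (1/2)`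
  set ε₁ : ℝ := min (ε / 2) (1 / 2) with hε₁
  have hε₁0 : 0 < ε₁ := lt_min (half_pos hε) one_half_pos
  have hε₁ε : 2 * ε₁ ≤ ε := by have := min_le_left (ε / 2) (1 / 2); linarith
  have hε₁1 : ε₁ ≤ 1 / 2 := min_le_right _ _
  filter_upwards [hlim (R + 1) ε₁ hε₁0,
    Filter.eventually_ge_atTop ⌈max (R + 1) (1 / ε₁)⌉₊] with k hk1 hk2
  have hk2' : max (R + 1) (1 / ε₁) ≤ (k : ℝ) := (Nat.le_ceil _).trans (by exact_mod_cast hk2)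
  have hkR : R + 1 ≤ k := (le_max_left _ _).trans hk2'
  have hkε : 1 / ((k : ℝ) + 1) ≤ ε₁ := by
    have h1 : 1 / ε₁ ≤ k := (le_max_right _ _).trans hk2'
    rw [div_le_iff₀ hε₁0] at h1
    rw [div_le_iff₀ (by positivity)]
    nlinarith
  obtain ⟨hAk, hBk⟩ := hJ k (d k) (hdJ k)
  obtain ⟨hM1, hM2⟩ := hk1
  refine ⟨fun p hp hpR => ?_, fun i hi => ?_⟩
  · obtain ⟨a, ha, hap⟩ := hM1 p hp (by rw [dist_zero_right]; linarith)
    have haR : ‖a‖ ≤ k := by linarith [norm_le_norm_add_dist a p]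
    obtain ⟨i, hi⟩ := hAk a ha haR
    refine ⟨i, ?_⟩
    calc dist (x (φ k (d k)) i + τ k (d k)) p
        ≤ dist (x (φ k (d k)) i + τ k (d k)) a + dist a p := dist_triangle _ _ _
      _ ≤ ε₁ + ε₁ := add_le_add (hi.trans hkε) hap
      _ ≤ ε := by linarith
  · obtain ⟨p', hp', hip'⟩ := hBk i (hi.trans (by linarith))
    have hp'R : dist p' 0 ≤ R + 1 := by
      rw [dist_zero_right]
      have := norm_le_norm_add_dist p' (x (φ k (d k)) i + τ k (d k))
      rw [dist_comm] at this
      linarith [hip'.trans hkε]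
    obtain ⟨s, hs, hps⟩ := hM2 p' hp' hp'R
    refine ⟨s, hs, ?_⟩
    calc dist (x (φ k (d k)) i + τ k (d k)) s
        ≤ dist (x (φ k (d k)) i + τ k (d k)) p' + dist p' s := dist_triangle _ _ _
      _ ≤ ε₁ + ε₁ := add_le_add (hip'.trans hkε) hps
      _ ≤ ε := by linarith

/-! ## The origin survives in the limit -/

/-- If eventually every `T k` contains `0`, `T k → Y` locally and `Y` is `δ`-separated
(`δ > 0`), then `0 ∈ Y`: the partners in `Y` of the root have arbitrarily small norm, and two of
them closer than `δ` coincide. [folklore] -/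
theorem zero_mem_of_ballMatch {T : ℕ → Set E} {Y : Set E} {δ : ℝ} (hδ : 0 < δ)
    (hYsep : ∀ p ∈ Y, ∀ q ∈ Y, p ≠ q → δ ≤ dist p q)
    (h0 : ∀ᶠ k in atTop, (0 : E) ∈ T k)
    (hlim : ∀ R' η : ℝ, 0 < η → ∀ᶠ k in atTop, BallMatch η R' 0 (T k) Y) :
    (0 : E) ∈ Y := by
  have hnear : ∀ η : ℝ, 0 < η → ∃ y ∈ Y, ‖y‖ ≤ η := by
    intro η hη
    obtain ⟨k, hk, hk0⟩ := ((hlim 0 η hη).and h0).exists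
    obtain ⟨y, hy, hy0⟩ := hk.2 0 hk0 (by rw [dist_self])
    exact ⟨y, hy, by rwa [dist_zero_left] at hy0⟩
  obtain ⟨y₁, hy₁, hy₁n⟩ := hnear (δ / 4) (by positivity)
  by_contra h0Y
  have hy₁0 : y₁ ≠ 0 := fun h => h0Y (h ▸ hy₁)
  have hpos : 0 < ‖y₁‖ := norm_pos_iff.2 hy₁0
  obtain ⟨y₂, hy₂, hy₂n⟩ := hnear (min (‖y₁‖ / 2) (δ / 4)) (lt_min (half_pos hpos) (by positivity))
  have hne : y₂ ≠ y₁ := by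
    intro h
    rw [h] at hy₂n
    linarith [min_le_left (‖y₁‖ / 2) (δ / 4)]
  have h := hYsep y₂ hy₂ y₁ hy₁ hne
  have h' : dist y₂ y₁ ≤ ‖y₂‖ + ‖y₁‖ := dist_le_norm_add_norm _ _
  linarith [min_le_right (‖y₁‖ / 2) (δ / 4)]

end General

/-! ## Defect-free balls from zero defect density (in `ℝ³`) -/

/-- **Defect-free balls.** Let `S ⊆ ℝ³` be `δ`-separated (`δ > 0`) and let `bad` be a property of
points whose occurrences in `S` have density zero uniformly over balls about the origin: for every
`θ > 0` there is `L₀` with `#{y ∈ S : ‖y‖ ≤ L, bad y} ≤ θ L³` for all `L ≥ L₀`.  Then for every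
`r > 0` some open ball of radius `r` contains no bad point of `S`.  (Grid of `n³` pairwise disjoint
open `r`-balls centred at `2r·k`, `k ∈ {0,…,n-1}³`, all inside `B̄_{5rn}(0)`; with `θ = 1/(250 r³)`
and `5rn ≥ L₀` the bad points there number `≤ n³/2 < n³`, so some grid ball has none.) [folklore] -/
theorem exists_ball_forall_not {S : Set (EuclideanSpace ℝ (Fin 3))}
    {bad : EuclideanSpace ℝ (Fin 3) → Prop} {δ : ℝ} (hδ : 0 < δ)
    (hsep : ∀ p ∈ S, ∀ q ∈ S, p ≠ q → δ ≤ dist p q)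
    (hdens : ∀ θ : ℝ, 0 < θ → ∃ L₀ : ℝ, ∀ L : ℝ, L₀ ≤ L →
      (({y | y ∈ S ∧ dist y 0 ≤ L ∧ bad y} : Set (EuclideanSpace ℝ (Fin 3))).ncard : ℝ) ≤
        θ * L ^ 3)
    {r : ℝ} (hr : 0 < r) :
    ∃ c : EuclideanSpace ℝ (Fin 3), ∀ z ∈ S, dist z c < r → ¬ bad z := by
  classical
  obtain ⟨L₀, hL₀⟩ := hdens (1 / (250 * r ^ 3)) (by positivity)
  -- the number of grid steps per axis
  set n : ℕ := ⌈L₀ / (5 * r)⌉₊ + 1 with hn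
  have hn1 : (1 : ℝ) ≤ n := by
    rw [hn]; exact_mod_cast Nat.le_add_left 1 _
  have hnL : L₀ ≤ 5 * r * n := by
    have h1 : L₀ / (5 * r) ≤ ⌈L₀ / (5 * r)⌉₊ := Nat.le_ceil _
    have h2 : (⌈L₀ / (5 * r)⌉₊ : ℝ) ≤ n := by rw [hn]; exact_mod_cast Nat.le_succ _
    have h3 : L₀ / (5 * r) ≤ n := h1.trans h2
    rw [div_le_iff₀ (by positivity)] at h3
    linarith
  -- the grid of spacing `2r`, indexed by `Fin 3 → ℕ`, and its points with indices `< n`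
  obtain ⟨g, hg⟩ : ∃ g : (Fin 3 → ℕ) → EuclideanSpace ℝ (Fin 3),
      ∀ k l, g k l = 2 * r * (k l : ℝ) :=
    ⟨fun k => WithLp.toLp 2 fun l => 2 * r * (k l : ℝ), fun k l => rfl⟩
  obtain ⟨ctr, hctr⟩ : ∃ ctr : (Fin 3 → Fin n) → EuclideanSpace ℝ (Fin 3),
      ∀ k, ctr k = g (fun l => (k l : ℕ)) := ⟨_, fun k => rfl⟩
  have hgnorm : ∀ k, ‖ctr k‖ ≤ 4 * r * n := fun k => by
    rw [hctr k]
    have h := norm_le_two_mul_of_abs_apply_le (by positivity : (0 : ℝ) ≤ 2 * r * n)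
      (v := g fun l => (k l : ℕ)) fun l => by
        rw [hg, abs_of_nonneg (by positivity)]
        have hkl : ((k l : ℕ) : ℝ) ≤ n := by exact_mod_cast (k l).isLt.le
        exact mul_le_mul_of_nonneg_left hkl (by positivity)
    linarith
  -- a point lies in at most one grid ball
  have huniq : ∀ (p : EuclideanSpace ℝ (Fin 3)) (k k' : Fin 3 → Fin n),
      dist p (ctr k) < r → dist p (ctr k') < r → k = k' := by
    intro p k k' hk hk'
    by_contra hne
    have hne' : (fun l => ((k l : Fin n) : ℕ)) ≠ fun l => ((k' l : Fin n) : ℕ) :=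
      fun h' => hne (funext fun l => Fin.ext (congr_fun h' l))
    have hsep' := le_norm_grid_sub (by positivity : (0 : ℝ) ≤ 2 * r) hg hne'
    rw [← hctr k, ← hctr k', ← dist_eq_norm] at hsep'
    linarith [dist_triangle_left (ctr k) (ctr k') p]
  -- suppose every grid ball contains a bad point of `S`
  by_contra hcon
  push Not at hcon
  choose f hfS hfd hfb using fun k : Fin 3 → Fin n => hcon (ctr k)
  have hfinj : Function.Injective f := fun k k' hkk' =>
    huniq (f k) k k' (hfd k) (by rw [hkk']; exact hfd k')
  -- the bad points chosen lie in `B̄_{5rn}(0)`, a finite `δ`-separated set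
  have hBfin :
      ({y | y ∈ S ∧ dist y 0 ≤ 5 * r * n ∧ bad y} : Set (EuclideanSpace ℝ (Fin 3))).Finite :=
    finite_of_forall_le_dist_of_subset_closedBall hδ
      (fun p hp q hq hpq => hsep p hp.1 q hq.1 hpq) (c := 0) (R := 5 * r * n)
      fun y hy => mem_closedBall.2 hy.2.1
  have hrange : Set.range f ⊆ {y | y ∈ S ∧ dist y 0 ≤ 5 * r * n ∧ bad y} := by
    rintro _ ⟨k, rfl⟩
    refine ⟨hfS k, ?_, hfb k⟩
    rw [dist_zero_right]
    have h1 : ‖f k‖ ≤ ‖ctr k‖ + dist (f k) (ctr k) := norm_le_norm_add_dist _ _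
    have h2 : r ≤ r * n := by nlinarith
    linarith [hgnorm k, hfd k]
  have hcard : (n : ℝ) ^ 3 ≤
      (({y | y ∈ S ∧ dist y 0 ≤ 5 * r * n ∧ bad y} :
        Set (EuclideanSpace ℝ (Fin 3))).ncard : ℝ) := by
    have h1 := Set.ncard_le_ncard hrange hBfin
    rw [Set.ncard_range_of_injective hfinj, Nat.card_eq_fintype_card, Fintype.card_fun,
      Fintype.card_fin, Fintype.card_fin] at h1
    exact_mod_cast h1
  have hbound := hL₀ (5 * r * n) hnL
  have : (1 / (250 * r ^ 3)) * (5 * r * n) ^ 3 = (n : ℝ) ^ 3 / 2 := by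
    field_simp
    ring
  rw [this] at hbound
  have hn3 : (1 : ℝ) ≤ (n : ℝ) ^ 3 := one_le_pow₀ hn1
  linarith

end Summit.AtomisticToContinuum.Crystallization.Theorems.HullExactShells

end
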